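import Literature.NumberTheory.LFunctions.SawtoothPartialSums
import Literature.NumberTheory.LFunctions.ExplicitFormulaPsiCharZeros
import HarnessLib

/-!
# The value of a Dirichlet `L`-function at `s = 0`: `L(0, χ) = -B_{1,χ}`, and `B_{1,χ} ≠ 0` for odd `χ`

Topic `Literature/NumberTheory/LFunctions`. THEOREMS (everything proved; no definitions, no named
facts).

Mathlib evaluates the Hurwitz zeta functions at the *negative* integers
(`HurwitzZeta.hurwitzZeta_neg_nat`, hypothesis `k ≠ 0`) but not at `s = 0`, where the Dirichlet
series of the sine zeta function converges only conditionally. We supply the missing value and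
deduce the classical formula for `L(0, χ)`:

* `sinZeta_one` — for `0 < x < 1`, `sinZeta x 1 = π (1/2 - x)`, i.e.
  `∑_{n ≥ 1} sin(2πnx)/n = π(1/2 - x)` for the analytically continued sine zeta function. Proof:
  the partial sums `T_N(x) = ∑_{n ≤ N} sin(2πnx)/n` satisfy
  `|T_N - π(1/2 - x)| ≤ 1/((2N+1) min(x, 1-x))` (the tree's `AFE.abs_sawErr_le`, Titchmarsh
  §4.7); an Abel summation gives, for real `1 < s ≤ 2`,
  `|sinZeta x s - π(1/2 - x)| ≤ (s-1)/min(x, 1-x)` (`norm_sinZeta_sub_le`), and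
  `s ↦ sinZeta x s` is continuous at `s = 1` (`HurwitzZeta.differentiableAt_sinZeta`).
* `hurwitzZetaOdd_apply_zero` — `hurwitzZetaOdd x 0 = 1/2 - x` for `0 < x < 1` (functional
  equation `HurwitzZeta.hurwitzZetaOdd_one_sub` at `s = 1`).
* `LFunction_apply_zero_of_odd` — for an odd function `Φ : ZMod N → ℂ`,
  `ZMod.LFunction Φ 0 = -(1/N) ∑_j j Φ(j)` (`j` running over `0, …, N-1`).
* `dirichletLFunction_apply_zero_of_odd` — for an odd Dirichlet character,
  `L(0, χ) = -B_{1,χ}` with `B_{1,χ} = (1/N) ∑_{a=1}^{N-1} a χ(a)`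
  [Washington1997, Theorem 4.2 (`n = 1`)].
* `sum_val_mul_ne_zero_of_odd` — for an odd character `χ` modulo a prime `p`,
  `∑_{a=1}^{p-1} a χ(a) ≠ 0` (i.e. `B_{1,χ} ≠ 0`), from `L(0, χ) ≠ 0` (the tree's
  `ExplicitPsiChar.LFunction_zero_ne_zero_of_odd`, [MontgomeryVaughan2007, Cor. 10.8]); the
  analytic input for the rank of the Stickelberger ideal ([Washington1997, §6.2]);
  `unitHom_sum_val_mul_ne_zero` restates it for a homomorphism `(ZMod p)ˣ →* ℂˣ`.

## References

* L. C. Washington, *Introduction to Cyclotomic Fields*, 2nd ed., GTM 83, Springer 1997,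
  Theorem 4.2 [Washington1997].
* H. L. Montgomery, R. C. Vaughan, *Multiplicative Number Theory I*, CUP 2007, Corollary 10.8
  [MontgomeryVaughan2007].
* E. C. Titchmarsh, *The Theory of the Riemann Zeta-Function*, 2nd ed., §4.7 [Titchmarsh1986].
-/

noncomputable section

open Real Finset Filter Topology HurwitzZeta

namespace Literature.NumberTheory.LFunctions

namespace LValueZero

/-! ### Partial sums of `∑ sin(2πnx)/n` -/

/-- The partial sums `T_N(x) = ∑_{n=1}^{N} sin(2π x n)/n` (the `n = 0` term is `0`) are
`T_N(x) = π (e_N(x) - x + 1/2)` with `e_N = AFE.sawErr N` the tree's smooth error function of the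
sawtooth series. [folklore] -/
theorem sinPartial_eq_sawErr (x : ℝ) (N : ℕ) :
    ∑ n ∈ range (N + 1), Real.sin (2 * π * x * n) / n = π * (AFE.sawErr N x - x + 1 / 2) := by
  induction N with
  | zero => simp [AFE.sawErr]
  | succ N ih =>
    rw [sum_range_succ, ih]
    have h : AFE.sawErr (N + 1) x =
        AFE.sawErr N x + Real.sin (2 * π * (N + 1 : ℕ) * x) / (π * (N + 1 : ℕ)) := by
      simp only [AFE.sawErr]
      rw [Finset.sum_Icc_succ_top (by omega)]
      ring
    rw [h, show 2 * π * ((N + 1 : ℕ) : ℝ) * x = 2 * π * x * ((N + 1 : ℕ) : ℝ) by ring]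
    have hπ : (π : ℝ) ≠ 0 := Real.pi_ne_zero
    have hN : ((N + 1 : ℕ) : ℝ) ≠ 0 := by positivity
    field_simp
    ring

/-- **Boundedly convergent sawtooth series**: for `0 < x < 1` and every `N`,
`|T_N(x) - π(1/2 - x)| ≤ 1/((2N+1) min(x, 1-x))`. [cite: Titchmarsh1986, §4.7] -/
theorem abs_sinPartial_sub_le {x : ℝ} (hx0 : 0 < x) (hx1 : x < 1) (N : ℕ) :
    |∑ n ∈ range (N + 1), Real.sin (2 * π * x * n) / n - π * (1 / 2 - x)| ≤
      1 / ((2 * N + 1) * min x (1 - x)) := by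
  rw [sinPartial_eq_sawErr]
  have h := AFE.abs_sawErr_le N hx0 hx1
  have hm : 0 < min x (1 - x) := lt_min hx0 (by linarith)
  rw [show π * (AFE.sawErr N x - x + 1 / 2) - π * (1 / 2 - x) = π * AFE.sawErr N x by ring,
    abs_mul, abs_of_pos Real.pi_pos]
  calc π * |AFE.sawErr N x| ≤ π * (1 / ((2 * N + 1) * π * min x (1 - x))) :=
        mul_le_mul_of_nonneg_left h Real.pi_pos.le
    _ = 1 / ((2 * N + 1) * min x (1 - x)) := by
        have hπ : (π : ℝ) ≠ 0 := Real.pi_ne_zero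
        field_simp

/-! ### Abel summation for `∑ sin(2πnx) n^{-s}`, `s > 1` real -/

/-- **Abel summation** (finite form): with `T_N = ∑_{n ≤ N} a_n`,
`∑_{n ≤ N} a_n c_n = T_N c_N + ∑_{n < N} T_n (c_n - c_{n+1})`. [folklore] -/
theorem sum_range_mul_eq_abel (a c : ℕ → ℝ) (N : ℕ) :
    ∑ n ∈ range (N + 1), a n * c n =
      (∑ n ∈ range (N + 1), a n) * c N +
        ∑ n ∈ range N, (∑ k ∈ range (n + 1), a k) * (c n - c (n + 1)) := by
  induction N with
  | zero => simp
  | succ N ih =>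
    have e1 : ∑ n ∈ range (N + 1 + 1), a n = (∑ n ∈ range (N + 1), a n) + a (N + 1) :=
      sum_range_succ a (N + 1)
    have e2 : ∑ n ∈ range (N + 1), (∑ k ∈ range (n + 1), a k) * (c n - c (n + 1)) =
        ∑ n ∈ range N, (∑ k ∈ range (n + 1), a k) * (c n - c (n + 1)) +
          (∑ k ∈ range (N + 1), a k) * (c N - c (N + 1)) :=
      sum_range_succ _ N
    rw [sum_range_succ (fun n => a n * c n) (N + 1), ih, e1, e2]
    ring

/-- The weights are non-negative: `(n+1)^{1-s} ≤ n^{1-s}` for `s ≥ 1`, `n ≥ 1`. [folklore] -/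
theorem rpow_succ_le_rpow {s : ℝ} (hs : 1 ≤ s) {n : ℕ} (hn : 1 ≤ n) :
    ((n : ℝ) + 1) ^ (1 - s) ≤ (n : ℝ) ^ (1 - s) := by
  have hn0 : (0 : ℝ) < n := by exact_mod_cast hn
  have h := Real.antitoneOn_rpow_Ioi_of_exponent_nonpos (r := 1 - s) (by linarith)
    (Set.mem_Ioi.mpr hn0) (Set.mem_Ioi.mpr (by positivity : (0 : ℝ) < n + 1)) (by linarith)
  simpa using h

/-- `n^{1-s} - (n+1)^{1-s} ≤ (s-1) n^{-s}` for `1 < s ≤ 2`, `n ≥ 1` (Bernoulli's inequality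
`(1 + 1/n)^{s-1} ≤ 1 + (s-1)/n`). [folklore] -/
theorem rpow_sub_rpow_succ_le {s : ℝ} (hs1 : 1 < s) (hs2 : s ≤ 2) {n : ℕ} (hn : 1 ≤ n) :
    (n : ℝ) ^ (1 - s) - ((n : ℝ) + 1) ^ (1 - s) ≤ (s - 1) * (n : ℝ) ^ (-s) := by
  have hn0 : (0 : ℝ) < n := by exact_mod_cast hn
  have hr0 : 0 ≤ s - 1 := by linarith
  have hr1 : s - 1 ≤ 1 := by linarith
  have hu0 : (0 : ℝ) ≤ 1 / n := by positivity
  have hu : (-1 : ℝ) ≤ 1 / n := by linarith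
  have hB : (1 + 1 / (n : ℝ)) ^ (s - 1) ≤ 1 + (s - 1) * (1 / n) :=
    rpow_one_add_le_one_add_mul_self hu hr0 hr1
  have hApos : 0 < (1 + 1 / (n : ℝ)) ^ (s - 1) := Real.rpow_pos_of_pos (by positivity) _
  have hBpos : 0 < 1 + (s - 1) * (1 / (n : ℝ)) := by positivity
  have hC : 1 - (s - 1) * (1 / n) ≤ (1 + 1 / (n : ℝ)) ^ (1 - s) := by
    rw [show (1 : ℝ) - s = -(s - 1) by ring, Real.rpow_neg (by positivity)]
    calc 1 - (s - 1) * (1 / (n : ℝ)) ≤ (1 + (s - 1) * (1 / (n : ℝ)))⁻¹ := by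
          rw [inv_eq_one_div, le_div_iff₀ hBpos]
          nlinarith [sq_nonneg ((s - 1) * (1 / (n : ℝ)))]
      _ ≤ ((1 + 1 / (n : ℝ)) ^ (s - 1))⁻¹ := inv_anti₀ hApos hB
  have hsplit : ((n : ℝ) + 1) ^ (1 - s) = (n : ℝ) ^ (1 - s) * (1 + 1 / (n : ℝ)) ^ (1 - s) := by
    rw [← Real.mul_rpow hn0.le (by positivity)]
    congr 1
    field_simp
  have hns : (n : ℝ) ^ (1 - s) * (1 / n) = (n : ℝ) ^ (-s) := by
    rw [show (1 : ℝ) - s = -s + 1 by ring, Real.rpow_add hn0, Real.rpow_one]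
    field_simp
  have hn1s : 0 ≤ (n : ℝ) ^ (1 - s) := Real.rpow_nonneg hn0.le _
  calc (n : ℝ) ^ (1 - s) - ((n : ℝ) + 1) ^ (1 - s)
      ≤ (n : ℝ) ^ (1 - s) - (n : ℝ) ^ (1 - s) * (1 - (s - 1) * (1 / n)) := by
        rw [hsplit]
        exact sub_le_sub_left (mul_le_mul_of_nonneg_left hC hn1s) _
    _ = (s - 1) * ((n : ℝ) ^ (1 - s) * (1 / n)) := by ring
    _ = (s - 1) * (n : ℝ) ^ (-s) := by rw [hns]

/-- **The sine zeta function near `s = 1`.** For `0 < x < 1` and real `1 < s ≤ 2`,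
`‖sinZeta x s - π(1/2 - x)‖ ≤ (s-1)/min(x, 1-x)` (Abel summation of `∑ sin(2πnx) n^{-s}`
against the boundedly convergent partial sums `T_n(x)`). [folklore] -/
theorem norm_sinZeta_sub_le {x : ℝ} (hx0 : 0 < x) (hx1 : x < 1) {s : ℝ} (hs1 : 1 < s)
    (hs2 : s ≤ 2) :
    ‖sinZeta x s - ((π * (1 / 2 - x) : ℝ) : ℂ)‖ ≤ (s - 1) / min x (1 - x) := by
  -- notation
  set m : ℝ := min x (1 - x) with hm
  have hm0 : 0 < m := lt_min hx0 (by linarith)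
  set L : ℝ := π * (1 / 2 - x) with hL
  set a : ℕ → ℝ := fun n => Real.sin (2 * π * x * n) / n with ha
  set c : ℕ → ℝ := fun n => (n : ℝ) ^ (1 - s) with hc
  set T : ℕ → ℝ := fun N => ∑ n ∈ range (N + 1), a n with hT
  have hTsum : ∀ N, ∑ n ∈ range (N + 1), a n = T N := fun N => rfl
  -- the terms of the Dirichlet series of `sinZeta x s` are `a n * c n`
  have hterm : ∀ n : ℕ, Real.sin (2 * π * x * n) / (n : ℝ) ^ s = a n * c n := by
    intro n
    rcases Nat.eq_zero_or_pos n with rfl | hn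
    · simp [ha]
    · have hn0 : (0 : ℝ) < n := by exact_mod_cast hn
      simp only [ha, hc]
      rw [show (1 : ℝ) - s = -s + 1 by ring, Real.rpow_add hn0, Real.rpow_one,
        Real.rpow_neg hn0.le]
      field_simp
  have hcplx : ∀ n : ℕ,
      (Real.sin (2 * π * x * n) : ℂ) / (n : ℂ) ^ (s : ℂ) = ((a n * c n : ℝ) : ℂ) := by
    intro n
    rw [← hterm, Complex.ofReal_div, Complex.ofReal_cpow (Nat.cast_nonneg n),
      Complex.ofReal_natCast]
  have hS := hasSum_nat_sinZeta x (s := (s : ℂ)) (by simpa using hs1)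
  have hS' : HasSum (fun n : ℕ => ((a n * c n : ℝ) : ℂ)) (sinZeta x s) :=
    hS.congr_fun fun n => (hcplx n).symm
  set Z : ℝ := (sinZeta x s).re with hZ
  have hre : HasSum (fun n : ℕ => a n * c n) Z := by
    simpa using Complex.hasSum_re hS'
  have him : (sinZeta x (s : ℂ)).im = 0 := by
    have h1 : HasSum (fun _ : ℕ => (0 : ℝ)) (sinZeta x s).im := by
      simpa using Complex.hasSum_im hS'
    exact h1.unique hasSum_zero
  have hZeq : sinZeta x (s : ℂ) = (Z : ℂ) := Complex.ext (by simp [hZ]) (by simp [him])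
  -- `c N → 0`
  have hc0 : Tendsto c atTop (𝓝 0) := by
    have h := (tendsto_rpow_neg_atTop (by linarith : 0 < s - 1)).comp tendsto_natCast_atTop_atTop
    refine h.congr fun N => ?_
    simp only [Function.comp_apply, hc]
    congr 1
    ring
  have hcnn : ∀ N, 0 ≤ c N := fun N => Real.rpow_nonneg (Nat.cast_nonneg N) _
  -- bounds on `T`
  have hTL : ∀ N, |T N - L| ≤ 1 / ((2 * N + 1) * m) := fun N => abs_sinPartial_sub_le hx0 hx1 N
  have hTB : ∀ N, |T N| ≤ |L| + 1 / m := by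
    intro N
    have h1 := hTL N
    have h2 : 1 / ((2 * (N : ℝ) + 1) * m) ≤ 1 / m := by
      apply one_div_le_one_div_of_le hm0
      have : (0 : ℝ) ≤ 2 * N := by positivity
      nlinarith
    calc |T N| = |(T N - L) + L| := by ring_nf
      _ ≤ |T N - L| + |L| := abs_add_le _ _
      _ ≤ |L| + 1 / m := by linarith
  -- the Abel remainder `R N = ∑_{n<N} T n (c n - c (n+1)) - L (1 - c N)` is small
  set R : ℕ → ℝ := fun N => ∑ n ∈ range N, T n * (c n - c (n + 1)) - L * (1 - c N) with hR
  have hc1 : c 1 = 1 := by simp [hc]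
  have hRbound : ∀ N, 1 ≤ N → |R N| ≤ (s - 1) / m * (1 - 1 / N) := by
    intro N hN
    induction N, hN using Nat.le_induction with
    | base => simp [hR, hc1, hT, ha]
    | succ N hN ih =>
      have hN0 : (0 : ℝ) < N := by exact_mod_cast hN
      have hrec : R (N + 1) = R N + (T N - L) * (c N - c (N + 1)) := by
        simp only [hR]
        rw [sum_range_succ]
        ring
      have hw0 : 0 ≤ c N - c (N + 1) := by
        have := rpow_succ_le_rpow hs1.le hN
        simp only [hc]; push_cast; linarith
      have hw1 : c N - c (N + 1) ≤ (s - 1) * (N : ℝ) ^ (-s) := by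
        have := rpow_sub_rpow_succ_le hs1 hs2 hN
        simp only [hc]; push_cast; linarith
      have hNs : (N : ℝ) ^ (-s) ≤ 1 / N := by
        rw [one_div, ← Real.rpow_neg_one]
        exact Real.rpow_le_rpow_of_exponent_le (by exact_mod_cast hN) (by linarith)
      have key : |T N - L| * (c N - c (N + 1)) ≤ (s - 1) / m * (1 / N - 1 / (N + 1)) := by
        have e : (1 : ℝ) / N - 1 / (N + 1) = 1 / (N * (N + 1)) := by
          field_simp
          ring
        calc |T N - L| * (c N - c (N + 1))
            ≤ 1 / ((2 * N + 1) * m) * ((s - 1) * (1 / N)) := by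
              apply mul_le_mul (hTL N) (hw1.trans ?_) hw0 (by positivity)
              exact mul_le_mul_of_nonneg_left hNs (by linarith)
          _ = (s - 1) / m * (1 / ((2 * N + 1) * N)) := by
              field_simp
          _ ≤ (s - 1) / m * (1 / (N * (N + 1))) := by
              apply mul_le_mul_of_nonneg_left _ (by positivity)
              apply one_div_le_one_div_of_le (by positivity)
              nlinarith
          _ = (s - 1) / m * (1 / N - 1 / (N + 1)) := by rw [e]
      calc |R (N + 1)| = |R N + (T N - L) * (c N - c (N + 1))| := by rw [hrec]
        _ ≤ |R N| + |(T N - L) * (c N - c (N + 1))| := abs_add_le _ _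
        _ = |R N| + |T N - L| * (c N - c (N + 1)) := by rw [abs_mul, abs_of_nonneg hw0]
        _ ≤ (s - 1) / m * (1 - 1 / N) + (s - 1) / m * (1 / N - 1 / (N + 1)) := add_le_add ih key
        _ = (s - 1) / m * (1 - 1 / ((N + 1 : ℕ) : ℝ)) := by push_cast; ring
  -- hence `|∑_{n ≤ N} a n c n - L| ≤ (|L| + 1/m + |L|) c N + (s-1)/m` for `N ≥ 1`
  have hF : ∀ N, 1 ≤ N →
      |∑ n ∈ range (N + 1), a n * c n - L| ≤ (|L| + 1 / m + |L|) * c N + (s - 1) / m := by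
    intro N hN
    have hN0 : (0 : ℝ) < N := by exact_mod_cast hN
    have habel := sum_range_mul_eq_abel a c N
    have hdecomp : ∑ n ∈ range (N + 1), a n * c n - L = T N * c N + R N - L * c N := by
      rw [habel, hTsum]
      simp only [hR, hTsum]
      ring
    have hR' : |R N| ≤ (s - 1) / m := by
      refine (hRbound N hN).trans ?_
      have h1 : (0 : ℝ) ≤ 1 / N := by positivity
      have h2 : 0 ≤ (s - 1) / m := by positivity
      nlinarith
    rw [hdecomp]
    calc |T N * c N + R N - L * c N| ≤ |T N * c N| + |R N| + |L * c N| := by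
          linarith [abs_sub (T N * c N + R N) (L * c N), abs_add_le (T N * c N) (R N)]
      _ = |T N| * c N + |R N| + |L| * c N := by
          rw [abs_mul, abs_mul, abs_of_nonneg (hcnn N)]
      _ ≤ (|L| + 1 / m) * c N + (s - 1) / m + |L| * c N := by
          have h1 : |T N| * c N ≤ (|L| + 1 / m) * c N :=
            mul_le_mul_of_nonneg_right (hTB N) (hcnn N)
          linarith [hR']
      _ = (|L| + 1 / m + |L|) * c N + (s - 1) / m := by ring
  -- pass to the limit `N → ∞`
  have hlim1 : Tendsto (fun N => |∑ n ∈ range (N + 1), a n * c n - L|) atTop (𝓝 |Z - L|) :=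
    ((hre.tendsto_sum_nat.comp (tendsto_add_atTop_nat 1)).sub_const L).abs
  have hlim2 : Tendsto (fun N => (|L| + 1 / m + |L|) * c N + (s - 1) / m) atTop
      (𝓝 ((|L| + 1 / m + |L|) * 0 + (s - 1) / m)) :=
    (hc0.const_mul _).add_const _
  rw [mul_zero, zero_add] at hlim2
  have hZL : |Z - L| ≤ (s - 1) / m :=
    le_of_tendsto_of_tendsto hlim1 hlim2 (Filter.eventually_atTop.2 ⟨1, fun N hN => hF N hN⟩)
  rw [hZeq, ← Complex.ofReal_sub, Complex.norm_real, Real.norm_eq_abs]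
  exact hZL

/-- **`∑_{n ≥ 1} sin(2πnx)/n = π(1/2 - x)`** for `0 < x < 1`, as the value at `s = 1` of
Mathlib's (analytically continued) sine zeta function `sinZeta x`. [folklore] -/
theorem sinZeta_one {x : ℝ} (hx0 : 0 < x) (hx1 : x < 1) :
    sinZeta x 1 = ((π * (1 / 2 - x) : ℝ) : ℂ) := by
  set L : ℝ := π * (1 / 2 - x) with hL
  have hm0 : 0 < min x (1 - x) := lt_min hx0 (by linarith)
  set sq : ℕ → ℝ := fun k => 1 + 1 / ((k : ℝ) + 1) with hsq
  have hsq1 : ∀ k, 1 < sq k := fun k => by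
    simp only [hsq]
    have : (0 : ℝ) < 1 / ((k : ℝ) + 1) := by positivity
    linarith
  have hsq2 : ∀ k, sq k ≤ 2 := fun k => by
    simp only [hsq]
    have : 1 / ((k : ℝ) + 1) ≤ 1 := by
      rw [div_le_one (by positivity)]
      linarith [(k.cast_nonneg : (0 : ℝ) ≤ k)]
    linarith
  have h1 : Tendsto (fun k => sinZeta x (sq k : ℂ)) atTop (𝓝 (L : ℂ)) := by
    rw [tendsto_iff_norm_sub_tendsto_zero]
    refine squeeze_zero (fun k => norm_nonneg _)
      (fun k => norm_sinZeta_sub_le hx0 hx1 (hsq1 k) (hsq2 k)) ?_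
    have e : (fun k : ℕ => (sq k - 1) / min x (1 - x)) =
        fun k : ℕ => (1 / min x (1 - x)) * (1 / ((k : ℝ) + 1)) := by
      funext k
      simp only [hsq]
      field_simp
      ring
    rw [e]
    simpa using (tendsto_one_div_add_atTop_nhds_zero_nat).const_mul (1 / min x (1 - x))
  have h2 : Tendsto (fun k => sinZeta x (sq k : ℂ)) atTop (𝓝 (sinZeta x 1)) := by
    have hc : Continuous (sinZeta x) := (differentiableAt_sinZeta x).continuous
    have hs : Tendsto (fun k => ((sq k : ℝ) : ℂ)) atTop (𝓝 (1 : ℂ)) := by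
      have h0 : Tendsto sq atTop (𝓝 (1 + 0)) :=
        (tendsto_one_div_add_atTop_nhds_zero_nat).const_add 1
      rw [add_zero] at h0
      exact (Complex.continuous_ofReal.tendsto 1).comp h0
    exact (hc.tendsto 1).comp hs
  exact tendsto_nhds_unique h2 h1

/-- **The odd Hurwitz zeta function at `s = 0`**: `ζ_odd(x, 0) = 1/2 - x` for `0 < x < 1`
(the value `-B₁(x)` completing Mathlib's `hurwitzZetaOdd_neg_two_mul_nat`, `k ≠ 0`).
[cite: Washington1997, Theorem 4.2] -/
theorem hurwitzZetaOdd_apply_zero {x : ℝ} (hx0 : 0 < x) (hx1 : x < 1) :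
    hurwitzZetaOdd x 0 = 1 / 2 - x := by
  have h := hurwitzZetaOdd_one_sub (x : UnitAddCircle) (s := 1) (fun n hn => by
    have := congrArg Complex.re hn
    simp at this
    linarith [(n.cast_nonneg : (0 : ℝ) ≤ n)])
  rw [sub_self] at h
  rw [h, sinZeta_one hx0 hx1, Complex.Gamma_one, Complex.cpow_neg_one,
    show (π : ℂ) * 1 / 2 = π / 2 by ring, Complex.sin_pi_div_two]
  have hπ : (π : ℂ) ≠ 0 := Complex.ofReal_ne_zero.mpr Real.pi_ne_zero
  push_cast
  field_simp

/-- **`L(0, Φ)` for an odd function** `Φ : ℤ/Nℤ → ℂ`: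
`L(0, Φ) = ∑_j Φ(j) ζ_odd(j/N, 0) = -(1/N) ∑_{j=0}^{N-1} j Φ(j)`. [cite: Washington1997, Theorem 4.2] -/
theorem LFunction_apply_zero_of_odd {N : ℕ} [NeZero N] {Φ : ZMod N → ℂ} (hΦ : Φ.Odd) :
    ZMod.LFunction Φ 0 = -(∑ j : ZMod N, (j.val : ℂ) * Φ j) / N := by
  have hN0 : (0 : ℝ) < N := Nat.cast_pos.mpr (NeZero.pos N)
  have hΦ0 : Φ 0 = 0 := by
    have h := hΦ 0
    rw [neg_zero] at h
    have h3 : Φ 0 + Φ 0 = 0 := by linear_combination h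
    exact add_self_eq_zero.mp h3
  have hsum0 : ∑ j : ZMod N, Φ j = 0 := by
    have h1 : ∑ j : ZMod N, Φ (-j) = ∑ j : ZMod N, Φ j := by
      simpa using Equiv.sum_comp (Equiv.neg (ZMod N)) Φ
    have h2 : ∑ j : ZMod N, Φ (-j) = -∑ j : ZMod N, Φ j := by
      rw [← Finset.sum_neg_distrib]
      exact Finset.sum_congr rfl (fun j _ => hΦ j)
    have h3 : ∑ j : ZMod N, Φ j + ∑ j : ZMod N, Φ j = 0 := by
      linear_combination h1.symm.trans h2
    exact add_self_eq_zero.mp h3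
  have hval : ∀ j : ZMod N,
      Φ j * hurwitzZetaOdd (ZMod.toAddCircle j) 0 = Φ j * (1 / 2 - (j.val : ℂ) / N) := by
    intro j
    by_cases hj : j.val = 0
    · have : j = 0 := by rwa [ZMod.val_eq_zero] at hj
      subst this
      simp [hΦ0]
    · rw [ZMod.toAddCircle_apply]
      have hjpos : 0 < j.val := Nat.pos_of_ne_zero hj
      have hy0 : (0 : ℝ) < j.val / N := by positivity
      have hy1 : (j.val : ℝ) / N < 1 := by
        rw [div_lt_one hN0]
        exact_mod_cast ZMod.val_lt j
      rw [hurwitzZetaOdd_apply_zero hy0 hy1]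
      push_cast
      ring
  rw [ZMod.LFunction_def_odd hΦ, neg_zero, Complex.cpow_zero, one_mul,
    Finset.sum_congr rfl (fun j _ => hval j)]
  have : ∑ j : ZMod N, Φ j * (1 / 2 - (j.val : ℂ) / N) =
      (1 / 2) * ∑ j : ZMod N, Φ j - (∑ j : ZMod N, (j.val : ℂ) * Φ j) / N := by
    rw [Finset.mul_sum, Finset.sum_div, ← Finset.sum_sub_distrib]
    refine Finset.sum_congr rfl fun j _ => ?_
    ring
  rw [this, hsum0]
  ring

/-- **`L(0, χ) = -B_{1,χ}`** for an odd Dirichlet character `χ` modulo `N`, where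
`B_{1,χ} = (1/N) ∑_{a=1}^{N-1} a χ(a)` is the first generalized Bernoulli number.
[cite: Washington1997, Theorem 4.2] -/
theorem dirichletLFunction_apply_zero_of_odd {N : ℕ} [NeZero N] {χ : DirichletCharacter ℂ N}
    (hχ : χ.Odd) : χ.LFunction 0 = -(∑ a : ZMod N, (a.val : ℂ) * χ a) / N :=
  LFunction_apply_zero_of_odd hχ.to_fun

/-- **`B_{1,χ} ≠ 0` for odd `χ`**: for an odd Dirichlet character `χ` modulo a prime `p`,
`∑_{a=1}^{p-1} a χ(a) ≠ 0`. (From `L(0, χ) ≠ 0` — the functional equation and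
`L(1, χ̄) ≠ 0`, [MontgomeryVaughan2007, Corollary 10.8] — and `L(0, χ) = -B_{1,χ}`.)
[cite: Washington1997, Theorem 4.2; §4 (`B_{1,χ} ≠ 0` for odd `χ`)] -/
theorem sum_val_mul_ne_zero_of_odd {p : ℕ} [hp : Fact p.Prime] {χ : DirichletCharacter ℂ p}
    (hχ : χ.Odd) : ∑ a : ZMod p, (a.val : ℂ) * χ a ≠ 0 := by
  have hne : χ ≠ 1 := by
    rintro rfl
    have h1 : (1 : DirichletCharacter ℂ p) (-1) = 1 := by
      rw [show (-1 : ZMod p) = ((-1 : (ZMod p)ˣ) : ZMod p) by simp]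
      exact MulChar.one_apply_coe _
    have h2 : (1 : DirichletCharacter ℂ p) (-1) = -1 := hχ
    rw [h1] at h2
    norm_num at h2
  have hprim : χ.IsPrimitive := by
    rw [DirichletCharacter.isPrimitive_def]
    rcases hp.out.eq_one_or_self_of_dvd _ (DirichletCharacter.conductor_dvd_level χ) with h | h
    · exact absurd ((DirichletCharacter.eq_one_iff_conductor_eq_one (χ := χ)).mpr h) hne
    · exact h
  have hL := ExplicitPsiChar.LFunction_zero_ne_zero_of_odd hprim hne hχ
  rw [dirichletLFunction_apply_zero_of_odd hχ] at hL
  intro h0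
  rw [h0] at hL
  simp at hL

/-- The same for a homomorphism `ψ : (ℤ/pℤ)ˣ → ℂˣ` with `ψ(-1) = -1` (an odd character of
`Gal(ℚ(ζ_p)/ℚ) ≅ (ℤ/pℤ)ˣ`): `∑_{a ∈ (ℤ/pℤ)ˣ} a ψ(a) ≠ 0`, `a` the representative in
`[1, p-1]`. [cite: Washington1997, Theorem 4.2] -/
theorem unitHom_sum_val_mul_ne_zero {p : ℕ} [Fact p.Prime] (ψ : (ZMod p)ˣ →* ℂˣ)
    (hψ : ψ (-1) = -1) :
    ∑ a : (ZMod p)ˣ, ((a : ZMod p).val : ℂ) * (ψ a : ℂ) ≠ 0 := by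
  set χ : DirichletCharacter ℂ p := MulChar.ofUnitHom ψ with hχdef
  have hχa : ∀ a : (ZMod p)ˣ, χ a = ψ a := fun a => MulChar.ofUnitHom_coe ψ a
  have hodd : χ.Odd := by
    show χ (-1) = -1
    rw [show (-1 : ZMod p) = ((-1 : (ZMod p)ˣ) : ZMod p) by simp, hχa, hψ]
    simp
  have h := sum_val_mul_ne_zero_of_odd hodd
  have hconv : ∑ a : (ZMod p)ˣ, ((a : ZMod p).val : ℂ) * (ψ a : ℂ) =
      ∑ a : ZMod p, (a.val : ℂ) * χ a := by
    refine Finset.sum_bij_ne_zero (fun a _ _ => (a : ZMod p)) (fun a _ _ => Finset.mem_univ _)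
      (fun a₁ _ _ a₂ _ _ h => Units.ext h) (fun b _ hb => ?_) (fun a _ _ => by rw [hχa])
    have hb0 : b ≠ 0 := by
      rintro rfl
      simp at hb
    refine ⟨Units.mk0 b hb0, Finset.mem_univ _, ?_, Units.val_mk0 hb0⟩
    rw [← hχa, Units.val_mk0]
    exact hb
  rwa [← hconv] at h

end LValueZero

end Literature.NumberTheory.LFunctions
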